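import Literature.MathematicalPhysics.QuantumFieldTheory.Balaban1983to89.Node00.Record13SignFreeComparabilityOfBetaBox
import Literature.MathematicalPhysics.QuantumFieldTheory.Balaban1983to89.Node00.Record13LettersOfThm1CCMWZB
import Summits.QuantumFields.YangMills.Theorems.BalabanUVNodesK0AllTorusOfStepTokensGuardedZBLamPrintAx
import Literature.MathematicalPhysics.QuantumFieldTheory.Balaban1983to89.Node00.Record13LettersOfThm1CCMWZBChi
import Summits.QuantumFields.YangMills.Theorems.BalabanUVNodesK0V23DoorPackage

/-!
# K0ᴬ (stmt-QuantumFields-27238 `Record13SepCoPHInhabitedAx`) — `…K0V23DoorPackage` RE-CENTRED (OP 5a ∕ H3.3, the Ax EDITION): THE K0ᴬ DOOR PACKAGE FOR THE N24 ENGINE at the re-centred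
# witness — from the re-centred stub-3ᴬ′ᴮ text ALONE, per family below any radius ceiling, ONE ∃-package «door letters · ᴮ (8)-sentence · ᴮ (9)-token · LOCATED-K0ε₀ letter · window letters ·
# the sign-free box of `betaOfRecord₁₃Ax` at the window-edition member of `theta13OfThm1CCMWZBAx` (· comparability)» (the K0–K1 junction supply, K0 side)

Cell `pub-ymgap` (YM-PLAN Track A, D-0062), width seat `pub-ymgap-dag-n07-w3` (g22; N07 ∕ K0–K1 junction; OP 5a H3.3 Ax editions, `--supports stmt-QuantumFields-27238 --as helper`).
COUNT-NEUTRAL; theorems only — 0 `def` ∕ `sorry` ∕ `instance` ∕ `notation`; NEW additive leaf — dag-n07-w3 g17's `…K0V23DoorPackage` (195 l., key 20541 = K0⁷, banked as an aside by director-ym №467 (D))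
stays landed and true on its own text; nothing in the tree is edited.

WHAT THIS FILE IS.  The σ-IMAGE of `…K0V23DoorPackage` under director-ym №467 (D)'s re-centring of K0 (K0⁷ `Record13SepCoPHInhabited` ↦ K0ᴬ `Record13SepCoPHInhabitedAx`, stmt-QuantumFields-27238):
σ = { `theta13OfThm1CCMWZB ↦ theta13OfThm1CCMWZBAx` (def-Y (c), SAME ARITY; letters `X_theta13OfThm1CCMWZBAx` of (c) ∕ (d)), `betaOfRecord₁₃ ↦ betaOfRecord₁₃Ax`, `gOfRecord₁₃ ↦ gOfRecord₁₃Ax`,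
`Provisos₁₃SepCoPH ∕ SlotsNondegenerate₁₃ ↦ …Ax`, `UbgOfRecord₁₃CoP θ ↦ UbgOfRecord₁₃CoPChi θ (chiβOfRecord₁₃Ax θ)`, `PartCompat₁₃ θ ↦ PartCompat₁₃Chi θ (chiβOfRecord₁₃Ax θ)`, texts
`K0V23Defs.AbsBetaBox…GZB{,Eps0}At ↦ K0V23DefsAx.…AxAt` (p803783; `Prop8StepCoPGridGBAt`, `K0N09Eps0LetterAt` CENTRE-BLIND, verbatim), door module `…GuardedZBLam{,Print} ↦ …Ax` (p805243 ∕ p806943) }.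
Every proof is the source's proof term under σ; theorem names are the source's (new namespace `…Ax`).
HONEST FRAMING OF THE EDITION (binding; the source's framing below carries over verbatim under σ).  Count-neutral kernel bookkeeping; nothing of Bałaban asserted, valued or discharged;
every theorem CONDITIONAL on its displayed hypotheses (the re-centred stub-3 text ∕ NODE O's wall is inhabited nowhere); K0ᴬ 27238 ∕ K1ᴬ 27239 ∕ K3ᴬ 27247 OPEN; N07 ∕ N09 NOT discharged;
COUNT 8∕28 · K 1∕4 UNMOVED; R4 = the CONDITIONAL finite-𝕋⁴ rung `BalabanLadder.UV` only — NOT continuum ∕ ℝ⁴ ∕ OS; **the Yang–Mills mass gap (Clay) is NOT proved by any of this.**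

── THE SOURCE's OWN ACCOUNT (σ-applied; «K0⁷» there reads «K0ᴬ» here, «V23 text» reads «re-centred text (V24 candidate, registered by plan g99 — not here)») ──
WHY (dag-n24-c g20 ENGINE-v2 DESIGN §1–§3, bus 2026-08-30 I.18504 ∕ I.18531; offer I.18765).  The K1 engine of record «N09T5» (#11022) opens with a K0 prelude: destructure stub 1-G‴, SHRINK
its radius below the door ceiling `1∕(109824·L²)`, Prop. 8's top step ⟹ [15] Thm 1's (8)-sentence (53), the (9)-supplier from 2′ (k0-s1-w3), the threshold CHOICE `ε₀ := a₀` with the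
LOCATED-K0ε₀ letter `2a₀ ≤ ε₀L²` by `2 ≤ L²`, the registered box read at that label, the window shrink with letters, the transfer to the window-edition member, NODE O's comparability rows
`hcompBoth`.  Engine v2 re-keys all of it to the V23 ∕ ᴮ names (`K0V23Defs`, `K0Stub1BHolds`, `…GridGuardedB.gauge9SupplierG3B_of_prop6MemberP`, 53′).  This file IS that prelude in the ᴮ
currency as ONE theorem per shape, so the sibling engine obtains its K0 block by `obtain ⟨…⟩ := exists_doorPackageZB_of_absBetaBoxGZBAt F (h3 F) hamax`.

CONTENTS.  §1 `exists_doorZB_below` — stub 1ᴮ (PROVED) + 2′ + 53′ ⟹ below every ceiling `amax > 0` a door with riders, signs, `h15ᴮ`, `h9ᴮ` (g16's `exists_radius_antecedentsZB_inhabited_below`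
at `a₀ := min ā amax`); §2 ★ `exists_doorPackageZB_of_absBetaBoxGZBAt` — + the re-centred 3ᴬ′ᴮ text (V24 candidate) ⟹ the full package at the window-edition member, letters `(Efl, logz)` ∀-quantified INSIDE (β is
letter-blind, `rfl`), with the LOCATED-K0ε₀ letter at `ε₀ = a₀`; `…_comparable` — + NODE 00's `hcompBoth` rows (`Record13LettersOfThm1CCMWZB.hcompBoth_theta13OfThm1CCMWZBAx_of_betaBoxSignFree`);
§3 the `∀ F` forms for the skeleton's stub type `∀ F, …GZBAt F` and for the strengthened text `…GZBEps0At`.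

HONEST FRAMING (binding).  Repackaging BY NAME of LANDED theorems; NO β estimate — the box is the V23 stub-3ᴬ′ᴮ text taken as a HYPOTHESIS (NODE O's wall: [I] §1 p.264 «uniformly bounded»
stated, proof unpublished, [II′] p.355); no value of `a₀ ∕ ε₀ ∕ ε₂₉` asserted for anybody (∃-outputs); nothing of Bałaban's asserted; V23 NOT registered by this file; K0ᴬ (stmt-QuantumFields-27238)
∕ K1⁹ (27364) ∕ K3⁸ (27366) NOT closed; N07 ∕ N24 NOT discharged; counts UNMOVED (typed 28∕28 · discharged 8∕28, route display 8∕27 excl. NODE O; K 1∕4 — the chair's words); R4 = the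
CONDITIONAL finite-𝕋⁴ rung `BalabanLadder.UV` at fixed `ε = L^(−K)` only — NOT continuum ∕ ℝ⁴ ∕ OS; the Yang–Mills mass gap (Clay) is NOT proved by any of this.  Standard axioms only.
-/

noncomputable section

open scoped Matrix.Norms.L2Operator

namespace Summit.QuantumFields.YangMills.Theorems.K0V23DoorPackageAx

open Literature.MathematicalPhysics.QuantumFieldTheory.Balaban1983to89
open Literature.MathematicalPhysics.QuantumFieldTheory.Balaban1983to89.Node00
open Literature.MathematicalPhysics.QuantumFieldTheory.Balaban1983to89.T4Continuum
open Literature.MathematicalPhysics.QuantumFieldTheory.Balaban1983to89.FlowStep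
open Literature.MathematicalPhysics.QuantumFieldTheory.Balaban1983to89.B15DeterminingSets
open Summit.QuantumFields.YangMills.Theorems.K0V23Defs (K0N09Eps0LetterAt)
open Summit.QuantumFields.YangMills.Theorems.K0V23DefsAx (AbsBetaBoxAtThm1WitnessCCMGenGridGZBAxAt AbsBetaBoxAtThm1WitnessCCMGenGridGZBEps0AxAt absBetaBoxGenGridGZBAxAt_of_eps0)
open Summit.QuantumFields.YangMills.Theorems.K0V23Stub3NonVacuity (exists_radius_antecedentsZB_inhabited_below)
open Summit.QuantumFields.YangMills.Theorems.K0V23DoorPackage (exists_doorZB_below)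

variable (F : T4Family)

/-! ## §1  A door below every ceiling (stub 1ᴮ PROVED + 2′ printed + 53′; no box needed) -/

/-! ## §2  ★ The full K0 door package from the V23 stub-3ᴬ′ᴮ text -/

/-- The K0–N09 interface letter at the top of its window: `2a₀ ≤ a₀L²` (`12 ≤ L`). [cite: Balaban1987RG1, (0.1) p.251, (1.2) p.260 (bookkeeping)] -/
private theorem eps0Letter_top {a₀ : ℝ} (ha₀ : 0 ≤ a₀) : K0N09Eps0LetterAt F a₀ a₀ := by
  have hL : (12 : ℝ) ≤ (F.L : ℝ) := by exact_mod_cast F.hL11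
  have hL2 : (2 : ℝ) ≤ (F.L : ℝ) ^ 2 := by nlinarith
  show 2 * a₀ ≤ a₀ * (F.L : ℝ) ^ 2
  nlinarith

/-- β of the Z3 member is blind to the normalisation letters (`rfl`; DEF-1's census restated without the residue import). [cite: Balaban1987RG1, (1.20)–(1.22) p.264 (bookkeeping)] -/
private theorem census (j : ℕ) (γ a₀ ε₀ ε₂₉ B₃ B₃' a₁ : ℝ) (Efl logz : B12.RunParams → ℕ → ℝ) :
    betaOfRecord₁₃Ax F 2 (theta13OfThm1CCMWZBAx F 2 j γ a₀ ε₀ ε₂₉ B₃ B₃' a₀ a₁ Efl logz) =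
      betaOfRecord₁₃Ax F 2 (theta13OfThm1CCMWZBAx F 2 j γ a₀ ε₀ ε₂₉ B₃ B₃' a₀ a₁ (fun _ _ => 0) (fun _ _ => 0)) := rfl

/-- Abs box on `]0, γ₀]` ⟹ a shrunk window `γ ≤ ½` with both letters and the box there (node00's `exists_window_letters_signFree` + `FlowStep.box_mono`; `0 ≤ β′` read off the non-empty box `]0, γ₀]^1`).
[cite: Balaban1987RG1, Thm 1 p.259, §1 p.264 (bookkeeping)] -/
private theorem window_of_absBox {β : HBeta} {γ₀ β' : ℝ} (hγ0 : 0 < γ₀) (hlow : BetaLowerH (-β') γ₀ β) (hup : BetaUpperH β' γ₀ β) :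
    ∃ γ : ℝ, 0 < γ ∧ γ ≤ 1 / 2 ∧ -(-β') * γ ^ 2 ≤ 3 ∧ β' * γ ^ 2 ≤ 3 / 4 ∧ BetaLowerH (-β') γ β ∧ BetaUpperH β' γ β := by
  have hv : (fun _ : Fin (0 + 1) => γ₀) ∈ Box γ₀ 0 := mem_box.mpr fun _ => ⟨hγ0, le_rfl⟩
  have hβ' : 0 ≤ β' := by
    have h1 := hlow 0 _ hv
    have h2 := hup 0 _ hv
    linarith
  obtain ⟨γ, hγpos, hγle, hγhalf, hl, hu⟩ := exists_window_letters_signFree hγ0 hβ'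
  exact ⟨γ, hγpos, hγhalf, hl, hu, fun k v hv => hlow k v (box_mono hγle k hv), fun k v hv => hup k v (box_mono hγle k hv)⟩

/-- **★ THE K0 DOOR PACKAGE FROM THE V23 STUB-3ᴬ′ᴮ TEXT** (engine «N09T5»'s K0 prelude :203–232 in the V23 ∕ ᴮ currency, one call): if `K0V23DefsAx.AbsBetaBoxAtThm1WitnessCCMGenGridGZBAxAt F` then below
every ceiling `amax > 0` there are a door `(j, c, c₀, c₁; B₃, B₃′, a₀, a₁)`, `a₀ ≤ amax`, with riders and signs, the ᴮ (8)-sentence `h15` and ᴮ (9)-token `h9` under `A‴(c, c₀, c₁)` at radius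
`a₀`, the LOCATED-K0ε₀ letter AT `ε₀ = a₀`, a threshold `ε₂₉ > 0`, a bound `β′`, and a window `0 < γ ≤ ½` carrying the two letters `−(−β′)·γ² ≤ 3`, `β′·γ² ≤ ¾` and the sign-free box of the
β of record AT THE WINDOW-EDITION MEMBER `θ₁₃ᶜᶜᴹᵂᶻᴮ(j; γ; a₀; a₀, ε₂₉; B₃, B₃′, a₀, a₁; Efl, logz)` for EVERY `(Efl, logz)` (the half-window box of the text transferred by node00's
`betaLowerH∕betaUpperH_theta13OfThm1CCMWZBAx_of_half`; letter-blindness `rfl`).  CONDITIONAL on the V23 text; nothing asserted. [cite: Balaban1987RG1, Thm 1 p.259, (1.2) p.260, §1 (1.20)–(1.22) p.264, (2.9) p.266, (0.21) p.256; Balaban1985Variational, Thm 1 (8)–(9) p.279, Prop. 8 p.304; Balaban1985RegularSpaces, Prop. 6 p.99; Balaban1984PropagatorsII, (2.3) p.224; Balaban1988Convergent, (2.1) p.254, (2.4)–(2.5) p.255; Balaban1989LargeFieldII, p.355] -/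
theorem exists_doorPackageZB_of_absBetaBoxGZBAt (h3 : AbsBetaBoxAtThm1WitnessCCMGenGridGZBAxAt F) {amax : ℝ} (hamax : 0 < amax) :
    ∃ (j c c₀ c₁ : ℕ) (B₃ B₃' a₀ a₁ γ ε₂₉ β' : ℝ), c ≤ F.L ^ j ∧ c₀ ≤ j + 1 ∧ c₁ ≤ j ∧ 2 * (F.L : ℝ) ^ 2 ≤ B₃ ∧ 0 < B₃' ∧ 0 < a₀ ∧ a₀ ≤ amax ∧ 0 < a₁ ∧
      VariationalThm1RegSepCoP7MGB F 2
        (fun ν M g K k _s => c ≤ ν.M₁ ∧ k + c₀ ≤ F.m + K ∧ F.L ^ c₁ ∣ M ∧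
          ∀ i, 1 ≤ i → i ≤ k → dCubeSide (F.P K).L M (RkOfRecord (F.P K).L ν.r (g i)) i ∣ (F.P K).sitesPerDir 0) (lamDatum F) (dataSmall7LamTopOf F 2) B₃ a₀ a₁ ∧
      Gauge9RegSepTopStepGB F 2 (fun ν K Ω => suppDomOfRecord F ν K Ω) (F.L ^ j)
        (fun ν M g K k _s => c ≤ ν.M₁ ∧ k + c₀ ≤ F.m + K ∧ F.L ^ c₁ ∣ M ∧
          ∀ i, 1 ≤ i → i ≤ k → dCubeSide (F.P K).L M (RkOfRecord (F.P K).L ν.r (g i)) i ∣ (F.P K).sitesPerDir 0) (lamDatum F) (dataSmall7LamTopOf F 2) B₃ B₃' a₀ a₁ ∧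
      K0N09Eps0LetterAt F a₀ a₀ ∧ 0 < ε₂₉ ∧ 0 < γ ∧ γ ≤ 1 / 2 ∧ -(-β') * γ ^ 2 ≤ 3 ∧ β' * γ ^ 2 ≤ 3 / 4 ∧
      ∀ Efl logz : B12.RunParams → ℕ → ℝ,
        BetaLowerH (-β') γ (betaOfRecord₁₃Ax F 2 (theta13OfThm1CCMWZBAx F 2 j γ a₀ a₀ ε₂₉ B₃ B₃' a₀ a₁ Efl logz)) ∧
        BetaUpperH β' γ (betaOfRecord₁₃Ax F 2 (theta13OfThm1CCMWZBAx F 2 j γ a₀ a₀ ε₂₉ B₃ B₃' a₀ a₁ Efl logz)) := by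
  obtain ⟨j, c, c₀, c₁, B₃, B₃', a₀, a₁, hc, hc₀, hc₁, hB₃, hB₃', ha₀, ha₀le, ha₁, h15, h9⟩ := exists_doorZB_below F hamax
  obtain ⟨γ₀, ε₀, ε₂₉, β', hγ₀, -, hε', hlow, hup⟩ := h3 j c c₀ c₁ B₃ B₃' a₀ a₁ hc hc₀ hc₁ hB₃ hB₃' ha₀ ha₁ h15 h9
  -- the text's box at label `ε₀` IS the box at label `a₀` (β is `ε₀`-blind, `rfl`)
  have hlow₀ : BetaLowerH (-β') γ₀ (betaOfRecord₁₃Ax F 2 (theta13OfThm1CCMWZBAx F 2 j (1 / 2) a₀ a₀ ε₂₉ B₃ B₃' a₀ a₁ (fun _ _ => 0) (fun _ _ => 0))) := hlow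
  have hup₀ : BetaUpperH β' γ₀ (betaOfRecord₁₃Ax F 2 (theta13OfThm1CCMWZBAx F 2 j (1 / 2) a₀ a₀ ε₂₉ B₃ B₃' a₀ a₁ (fun _ _ => 0) (fun _ _ => 0))) := hup
  obtain ⟨γ, hγpos, hγh, hl, hu, hlow', hup'⟩ := window_of_absBox hγ₀ hlow₀ hup₀
  refine ⟨j, c, c₀, c₁, B₃, B₃', a₀, a₁, γ, ε₂₉, β', hc, hc₀, hc₁, hB₃, hB₃', ha₀, ha₀le, ha₁, h15, h9, eps0Letter_top F ha₀.le, hε', hγpos, hγh, hl, hu,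
    fun Efl logz => ?_⟩
  rw [census F j γ a₀ a₀ ε₂₉ B₃ B₃' a₁ Efl logz]
  exact ⟨betaLowerH_theta13OfThm1CCMWZBAx_of_half (Efl := fun _ _ => 0) (logz := fun _ _ => 0) hγh hlow',
    betaUpperH_theta13OfThm1CCMWZBAx_of_half (Efl := fun _ _ => 0) (logz := fun _ _ => 0) hγh hup'⟩

/-- **★ THE PACKAGE WITH NODE 00's COMPARABILITY ROWS**: as `exists_doorPackageZB_of_absBetaBoxGZBAt`, plus — at every `(Efl, logz)` — NODE 00's two 2-COMPARABILITY rows `(hcomp) ∧ (hcompRev)` of the (2.4)-profile `cR·ε_k` along in-window runs of the window-edition member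
(node00's `hcompBoth_theta13OfThm1CCMWZBAx_of_betaBoxSignFree` fed by the package's own box and letters; signs `0 ≤ B₃, 0 ≤ B₃′, 0 ≤ a₀, 0 ≤ a₁` from the package).  CONDITIONAL on the V23 text.
[cite: Balaban1988Convergent, (2.4)–(2.8) pp.255–256, (2.28) p.259; Balaban1987RG1, Thm 1 p.259, §1 (1.20)–(1.22) p.264; Balaban1985Variational, Thm 1 (8)–(9) p.279; Balaban1989LargeFieldII, p.355] -/
theorem exists_doorPackageZB_comparable_of_absBetaBoxGZBAt (h3 : AbsBetaBoxAtThm1WitnessCCMGenGridGZBAxAt F) {amax : ℝ} (hamax : 0 < amax) :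
    ∃ (j c c₀ c₁ : ℕ) (B₃ B₃' a₀ a₁ γ ε₂₉ β' : ℝ), c ≤ F.L ^ j ∧ c₀ ≤ j + 1 ∧ c₁ ≤ j ∧ 2 * (F.L : ℝ) ^ 2 ≤ B₃ ∧ 0 < B₃' ∧ 0 < a₀ ∧ a₀ ≤ amax ∧ 0 < a₁ ∧
      VariationalThm1RegSepCoP7MGB F 2
        (fun ν M g K k _s => c ≤ ν.M₁ ∧ k + c₀ ≤ F.m + K ∧ F.L ^ c₁ ∣ M ∧
          ∀ i, 1 ≤ i → i ≤ k → dCubeSide (F.P K).L M (RkOfRecord (F.P K).L ν.r (g i)) i ∣ (F.P K).sitesPerDir 0) (lamDatum F) (dataSmall7LamTopOf F 2) B₃ a₀ a₁ ∧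
      Gauge9RegSepTopStepGB F 2 (fun ν K Ω => suppDomOfRecord F ν K Ω) (F.L ^ j)
        (fun ν M g K k _s => c ≤ ν.M₁ ∧ k + c₀ ≤ F.m + K ∧ F.L ^ c₁ ∣ M ∧
          ∀ i, 1 ≤ i → i ≤ k → dCubeSide (F.P K).L M (RkOfRecord (F.P K).L ν.r (g i)) i ∣ (F.P K).sitesPerDir 0) (lamDatum F) (dataSmall7LamTopOf F 2) B₃ B₃' a₀ a₁ ∧
      K0N09Eps0LetterAt F a₀ a₀ ∧ 0 < ε₂₉ ∧ 0 < γ ∧ γ ≤ 1 / 2 ∧ -(-β') * γ ^ 2 ≤ 3 ∧ β' * γ ^ 2 ≤ 3 / 4 ∧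
      ∀ Efl logz : B12.RunParams → ℕ → ℝ,
        BetaLowerH (-β') γ (betaOfRecord₁₃Ax F 2 (theta13OfThm1CCMWZBAx F 2 j γ a₀ a₀ ε₂₉ B₃ B₃' a₀ a₁ Efl logz)) ∧
        BetaUpperH β' γ (betaOfRecord₁₃Ax F 2 (theta13OfThm1CCMWZBAx F 2 j γ a₀ a₀ ε₂₉ B₃ B₃' a₀ a₁ Efl logz)) ∧
        (∀ (p : B12.RunParams) (n : ℕ), n ≤ p.K →
          Step.InInterval (theta13OfThm1CCMWZBAx F 2 j γ a₀ a₀ ε₂₉ B₃ B₃' a₀ a₁ Efl logz).γ n (gOfRecord₁₃Ax F 2 (theta13OfThm1CCMWZBAx F 2 j γ a₀ a₀ ε₂₉ B₃ B₃' a₀ a₁ Efl logz) p) → ∀ m, m < n →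
            (theta13OfThm1CCMWZBAx F 2 j γ a₀ a₀ ε₂₉ B₃ B₃' a₀ a₁ Efl logz).s2.cR *
                epsOfRecord (theta13OfThm1CCMWZBAx F 2 j γ a₀ a₀ ε₂₉ B₃ B₃' a₀ a₁ Efl logz).ν (gOfRecord₁₃Ax F 2 (theta13OfThm1CCMWZBAx F 2 j γ a₀ a₀ ε₂₉ B₃ B₃' a₀ a₁ Efl logz) p) m ≤
              2 * ((theta13OfThm1CCMWZBAx F 2 j γ a₀ a₀ ε₂₉ B₃ B₃' a₀ a₁ Efl logz).s2.cR *
                epsOfRecord (theta13OfThm1CCMWZBAx F 2 j γ a₀ a₀ ε₂₉ B₃ B₃' a₀ a₁ Efl logz).ν (gOfRecord₁₃Ax F 2 (theta13OfThm1CCMWZBAx F 2 j γ a₀ a₀ ε₂₉ B₃ B₃' a₀ a₁ Efl logz) p) (m + 1))) ∧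
        (∀ (p : B12.RunParams) (n : ℕ), n ≤ p.K →
          Step.InInterval (theta13OfThm1CCMWZBAx F 2 j γ a₀ a₀ ε₂₉ B₃ B₃' a₀ a₁ Efl logz).γ n (gOfRecord₁₃Ax F 2 (theta13OfThm1CCMWZBAx F 2 j γ a₀ a₀ ε₂₉ B₃ B₃' a₀ a₁ Efl logz) p) → ∀ m, m < n →
            (theta13OfThm1CCMWZBAx F 2 j γ a₀ a₀ ε₂₉ B₃ B₃' a₀ a₁ Efl logz).s2.cR *
                epsOfRecord (theta13OfThm1CCMWZBAx F 2 j γ a₀ a₀ ε₂₉ B₃ B₃' a₀ a₁ Efl logz).ν (gOfRecord₁₃Ax F 2 (theta13OfThm1CCMWZBAx F 2 j γ a₀ a₀ ε₂₉ B₃ B₃' a₀ a₁ Efl logz) p) (m + 1) ≤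
              2 * ((theta13OfThm1CCMWZBAx F 2 j γ a₀ a₀ ε₂₉ B₃ B₃' a₀ a₁ Efl logz).s2.cR *
                epsOfRecord (theta13OfThm1CCMWZBAx F 2 j γ a₀ a₀ ε₂₉ B₃ B₃' a₀ a₁ Efl logz).ν (gOfRecord₁₃Ax F 2 (theta13OfThm1CCMWZBAx F 2 j γ a₀ a₀ ε₂₉ B₃ B₃' a₀ a₁ Efl logz) p) m)) := by
  obtain ⟨j, c, c₀, c₁, B₃, B₃', a₀, a₁, γ, ε₂₉, β', hc, hc₀, hc₁, hB₃, hB₃', ha₀, ha₀le, ha₁, h15, h9, hlet, hε', hγpos, hγh, hl, hu, hbox⟩ :=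
    exists_doorPackageZB_of_absBetaBoxGZBAt F h3 hamax
  have hL : (0 : ℝ) < (F.L : ℝ) := by exact_mod_cast lt_trans Nat.zero_lt_one F.hL.2
  have hB : (0 : ℝ) ≤ B₃ := (mul_pos two_pos (pow_pos hL 2)).le.trans hB₃
  refine ⟨j, c, c₀, c₁, B₃, B₃', a₀, a₁, γ, ε₂₉, β', hc, hc₀, hc₁, hB₃, hB₃', ha₀, ha₀le, ha₁, h15, h9, hlet, hε', hγpos, hγh, hl, hu, fun Efl logz => ?_⟩
  obtain ⟨hlo, hhi⟩ := hbox Efl logz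
  obtain ⟨h1, h2⟩ := hcompBoth_theta13OfThm1CCMWZBAx_of_betaBoxSignFree (Efl := Efl) (logz := logz) hγh hB hB₃'.le ha₀.le ha₁.le hlo hhi hl hu
  exact ⟨hlo, hhi, h1, h2⟩

/-! ## §3  The `∀ F` forms (the skeleton's stub type and the strengthened text) -/

/-- **The `∀ F` form for the skeleton's stub** `∀ F, …GZBAt F` (the type of `stub_absBetaBoxAtThm1WitnessCCMGenGridGZB13` once V23 is registered): the door package at every family, below any
family-dependent ceiling.  CONDITIONAL. [cite: Balaban1987RG1, Thm 1 p.259, §1 (1.20)–(1.22) p.264; Balaban1985Variational, Thm 1 (8)–(9) p.279; Balaban1989LargeFieldII, p.355] -/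
theorem forall_exists_doorPackageZB_of_forall_absBetaBoxGZBAt (h3 : ∀ F : T4Family, AbsBetaBoxAtThm1WitnessCCMGenGridGZBAxAt F) (amax : T4Family → ℝ) (hamax : ∀ F, 0 < amax F) :
    ∀ F : T4Family, ∃ (j c c₀ c₁ : ℕ) (B₃ B₃' a₀ a₁ γ ε₂₉ β' : ℝ), c ≤ F.L ^ j ∧ c₀ ≤ j + 1 ∧ c₁ ≤ j ∧ 2 * (F.L : ℝ) ^ 2 ≤ B₃ ∧ 0 < B₃' ∧ 0 < a₀ ∧ a₀ ≤ amax F ∧ 0 < a₁ ∧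
      VariationalThm1RegSepCoP7MGB F 2
        (fun ν M g K k _s => c ≤ ν.M₁ ∧ k + c₀ ≤ F.m + K ∧ F.L ^ c₁ ∣ M ∧
          ∀ i, 1 ≤ i → i ≤ k → dCubeSide (F.P K).L M (RkOfRecord (F.P K).L ν.r (g i)) i ∣ (F.P K).sitesPerDir 0) (lamDatum F) (dataSmall7LamTopOf F 2) B₃ a₀ a₁ ∧
      Gauge9RegSepTopStepGB F 2 (fun ν K Ω => suppDomOfRecord F ν K Ω) (F.L ^ j)
        (fun ν M g K k _s => c ≤ ν.M₁ ∧ k + c₀ ≤ F.m + K ∧ F.L ^ c₁ ∣ M ∧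
          ∀ i, 1 ≤ i → i ≤ k → dCubeSide (F.P K).L M (RkOfRecord (F.P K).L ν.r (g i)) i ∣ (F.P K).sitesPerDir 0) (lamDatum F) (dataSmall7LamTopOf F 2) B₃ B₃' a₀ a₁ ∧
      K0N09Eps0LetterAt F a₀ a₀ ∧ 0 < ε₂₉ ∧ 0 < γ ∧ γ ≤ 1 / 2 ∧ -(-β') * γ ^ 2 ≤ 3 ∧ β' * γ ^ 2 ≤ 3 / 4 ∧
      ∀ Efl logz : B12.RunParams → ℕ → ℝ,
        BetaLowerH (-β') γ (betaOfRecord₁₃Ax F 2 (theta13OfThm1CCMWZBAx F 2 j γ a₀ a₀ ε₂₉ B₃ B₃' a₀ a₁ Efl logz)) ∧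
        BetaUpperH β' γ (betaOfRecord₁₃Ax F 2 (theta13OfThm1CCMWZBAx F 2 j γ a₀ a₀ ε₂₉ B₃ B₃' a₀ a₁ Efl logz)) :=
  fun F => exists_doorPackageZB_of_absBetaBoxGZBAt F (h3 F) (hamax F)

/-- The strengthened text of LOCATED-K0ε₀ (`…GZBEps0At F`) yields the same package (it implies the V23 text, ✓p767853 `absBetaBoxGenGridGZBAxAt_of_eps0`). CONDITIONAL.
[cite: Balaban1987RG1, Thm 1 p.259, (1.2) p.260, §1 (1.20)–(1.22) p.264; Balaban1985Variational, Thm 1 (8)–(9) p.279 (bookkeeping)] -/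
theorem exists_doorPackageZB_of_absBetaBoxGZBEps0At (h : AbsBetaBoxAtThm1WitnessCCMGenGridGZBEps0AxAt F) {amax : ℝ} (hamax : 0 < amax) :
    ∃ (j c c₀ c₁ : ℕ) (B₃ B₃' a₀ a₁ γ ε₂₉ β' : ℝ), c ≤ F.L ^ j ∧ c₀ ≤ j + 1 ∧ c₁ ≤ j ∧ 2 * (F.L : ℝ) ^ 2 ≤ B₃ ∧ 0 < B₃' ∧ 0 < a₀ ∧ a₀ ≤ amax ∧ 0 < a₁ ∧
      VariationalThm1RegSepCoP7MGB F 2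
        (fun ν M g K k _s => c ≤ ν.M₁ ∧ k + c₀ ≤ F.m + K ∧ F.L ^ c₁ ∣ M ∧
          ∀ i, 1 ≤ i → i ≤ k → dCubeSide (F.P K).L M (RkOfRecord (F.P K).L ν.r (g i)) i ∣ (F.P K).sitesPerDir 0) (lamDatum F) (dataSmall7LamTopOf F 2) B₃ a₀ a₁ ∧
      Gauge9RegSepTopStepGB F 2 (fun ν K Ω => suppDomOfRecord F ν K Ω) (F.L ^ j)
        (fun ν M g K k _s => c ≤ ν.M₁ ∧ k + c₀ ≤ F.m + K ∧ F.L ^ c₁ ∣ M ∧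
          ∀ i, 1 ≤ i → i ≤ k → dCubeSide (F.P K).L M (RkOfRecord (F.P K).L ν.r (g i)) i ∣ (F.P K).sitesPerDir 0) (lamDatum F) (dataSmall7LamTopOf F 2) B₃ B₃' a₀ a₁ ∧
      K0N09Eps0LetterAt F a₀ a₀ ∧ 0 < ε₂₉ ∧ 0 < γ ∧ γ ≤ 1 / 2 ∧ -(-β') * γ ^ 2 ≤ 3 ∧ β' * γ ^ 2 ≤ 3 / 4 ∧
      ∀ Efl logz : B12.RunParams → ℕ → ℝ,
        BetaLowerH (-β') γ (betaOfRecord₁₃Ax F 2 (theta13OfThm1CCMWZBAx F 2 j γ a₀ a₀ ε₂₉ B₃ B₃' a₀ a₁ Efl logz)) ∧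
        BetaUpperH β' γ (betaOfRecord₁₃Ax F 2 (theta13OfThm1CCMWZBAx F 2 j γ a₀ a₀ ε₂₉ B₃ B₃' a₀ a₁ Efl logz)) :=
  exists_doorPackageZB_of_absBetaBoxGZBAt F (absBetaBoxGenGridGZBAxAt_of_eps0 F h) hamax

end Summit.QuantumFields.YangMills.Theorems.K0V23DoorPackageAx

end
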